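import Literature.NumberTheory.Sieve.RoughOmegaCellsClassesBVPairs
import Literature.NumberTheory.Sieve.BombieriFriedlanderIwaniecBoxes
import Literature.NumberTheory.Sieve.BombieriFriedlanderIwaniecBilinear
import Literature.NumberTheory.Sieve.BombieriFriedlanderIwaniecTrivialBound
import Literature.NumberTheory.Sieve.PolymathGEHPiecesPrimes
import HarnessLib

/-!
# Bombieri–Vinogradov for the `Ω`-cells of the rough integers, IV: covering the hyperbola by boxes

Topic `Literature/NumberTheory/Sieve`, sub-namespace `RoughCellsAP`.  Everything here is PROVED
and combinatorial.  The pairs `(m, p)` (`m` in the cell `Ω = j`, `p ≥ N₀` prime, `m p ≤ ⌊X⌋`) of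
`RoughOmegaCellsClassesBVPairs.lean` are covered by product boxes to which Theorem 0 (b) of
Bombieri–Friedlander–Iwaniec (the bilinear discrepancy `BFI.bilinDisc`) applies: the primes are cut
into the fine boxes `BFI.InBox X δ k` (`(X(1+δ)^{-k-1}, X(1+δ)^{-k}]`, BFI §15 p. 245) and, for each
`k`, the `m`-variable into the dyadic ranges `BFI.InBox ((1+δ)^k) 1 i` (`((1+δ)^k 2^{-i-1}, (1+δ)^k 2^{-i}]`),
so that the products of the box `(k, i)` lie in `(X 2^{-i-1}(1+δ)^{-1}, X 2^{-i}]`: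

* `exists_inBox_lt` — every integer `T(1+Δ)^{-K} < n ≤ T` lies in a box `k < K`;
* `product_boxes_subset_pairs`, `pairwiseDisjoint_boxes`, `pairs_sdiff_boxes_subset` — the boxes
  `k < K`, `i < I` are disjoint subsets of the pairs and miss only pairs with `m p ≤ X 2^{-I}` or
  `m p > X/(1+δ)` (when `(1+δ)^K > X`);
* `pairDisc_eq_sum_boxes_add` — the pair discrepancy splits accordingly;
* `pairDisc_box_eq_bilinDisc` — the discrepancy of a box is `BFI.bilinDisc` of the two indicators at
  the scales `M = (1+δ)^k 2^{-i-1}`, `N = X (1+δ)^{-k-1}`, whose norms are `≤ 2M + 1`, `≤ 2N + 1`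
  (`l2Sq_indicator_le`), and the prime indicator is a `primePiece` (`indicator_boxB_eq_primePiece`).

## References

* E. Bombieri, J. B. Friedlander, H. Iwaniec, *Primes in arithmetic progressions to large moduli*,
  Acta Math. 156 (1986), 203–251, §2 Theorem 0 p. 211 and §15 p. 245. [BombieriFriedlanderIwaniecActa1986]
-/

open Finset
open scoped ArithmeticFunction.Omega

namespace Literature.NumberTheory.Sieve

namespace RoughCellsAP

open BFI

/-! Local notation (as in `RoughOmegaCellsClassesBVPairs.lean`), and the two kinds of boxes. -/
local notation3 (prettyPrint := false) "cellΩ" N₀:max T:max i:max =>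
  Finset.filter (fun b : ℕ => ArithmeticFunction.cardFactors b = i) (roughIcc N₀ T)
local notation3 (prettyPrint := false) "primesIn" N₀:max T:max =>
  Finset.filter (fun p : ℕ => Nat.Prime p ∧ N₀ ≤ p) (Finset.Icc 1 T)
local notation3 (prettyPrint := false) "pairs" N₀:max T:max j:max =>
  Finset.filter (fun x : ℕ × ℕ => x.1 * x.2 ≤ T) ((cellΩ N₀ T j) ×ˢ (primesIn N₀ T))
local notation3 (prettyPrint := false) "boxA" N₀:max T:max j:max δ:max k:max i:max =>
  Finset.filter (fun m : ℕ => BFI.InBox ((1 + δ) ^ k) 1 i m) (cellΩ N₀ T j)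
local notation3 (prettyPrint := false) "boxB" N₀:max T:max X:max δ:max k:max =>
  Finset.filter (fun p : ℕ => BFI.InBox X δ k p) (primesIn N₀ T)

/-! ### Every integer lies in a box -/

/-- **Every `T(1+Δ)^{-K} < n ≤ T` lies in a box `k < K`** (`n ≥ 1`). [folklore] -/
theorem exists_inBox_lt {T Δ : ℝ} {K n : ℕ} (hn1 : 1 ≤ n)
    (hlow : T / (1 + Δ) ^ K < n) (hnT : (n : ℝ) ≤ T) : ∃ k < K, InBox T Δ k n := by
  classical
  have hK : K ≠ 0 := by
    rintro rfl
    rw [pow_zero, div_one] at hlow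
    linarith
  have hK' : boxLow T Δ (K - 1) < n := by
    unfold boxLow; rwa [Nat.sub_add_cancel (Nat.pos_of_ne_zero hK)]
  have hex : ∃ k, boxLow T Δ k < n := ⟨K - 1, hK'⟩
  refine ⟨Nat.find hex, ?_, by omega, Nat.find_spec hex, ?_⟩
  · have : Nat.find hex ≤ K - 1 := Nat.find_min' hex hK'
    omega
  · rcases Nat.eq_zero_or_pos (Nat.find hex) with h0 | hpos
    · rw [h0]; unfold boxHigh; simpa using hnT
    · have := Nat.find_min hex (show Nat.find hex - 1 < Nat.find hex by omega)
      rw [not_lt] at this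
      have heq : boxHigh T Δ (Nat.find hex) = boxLow T Δ (Nat.find hex - 1) := by
        rw [← boxHigh_succ]; congr 1; omega
      rw [heq]; exact this

/-! ### The boxes are disjoint subsets of the pairs -/

/-- A product box is a set of pairs: `m ≤ (1+δ)^k` and `p ≤ X(1+δ)^{-k}` give `m p ≤ X`. [folklore] -/
theorem product_boxes_subset_pairs {N₀ j : ℕ} {X δ : ℝ} (hδ : 0 ≤ δ) (k i : ℕ) :
    (boxA N₀ ⌊X⌋₊ j δ k i) ×ˢ (boxB N₀ ⌊X⌋₊ X δ k) ⊆ pairs N₀ ⌊X⌋₊ j := by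
  intro x hx
  simp only [Finset.mem_product, Finset.mem_filter] at hx
  obtain ⟨⟨hm, hmbox⟩, hp, hpbox⟩ := hx
  rw [Finset.mem_filter]
  refine ⟨Finset.mem_product.2 ⟨Finset.mem_filter.2 hm, Finset.mem_filter.2 hp⟩, ?_⟩
  have hpow : 0 < (1 + δ) ^ k := by positivity
  have h1 : (x.1 : ℝ) ≤ (1 + δ) ^ k := by
    have h := hmbox.2.2
    unfold boxHigh at h
    exact h.trans (div_le_self hpow.le (one_le_pow₀ (by norm_num)))
  have h2 : (x.2 : ℝ) ≤ X / (1 + δ) ^ k := hpbox.2.2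
  have h3 : (x.1 : ℝ) * x.2 ≤ X := by
    calc (x.1 : ℝ) * x.2 ≤ (1 + δ) ^ k * (X / (1 + δ) ^ k) := mul_le_mul h1 h2 (Nat.cast_nonneg _) hpow.le
      _ = X := by field_simp
  exact Nat.le_floor (by exact_mod_cast h3)

/-- Distinct boxes are disjoint (`X > 0`, `δ ≥ 0`). [folklore] -/
theorem pairwiseDisjoint_boxes {N₀ T j : ℕ} {X δ : ℝ} (hX : 0 < X) (hδ : 0 ≤ δ) (s : Finset (ℕ × ℕ)) :
    (s : Set (ℕ × ℕ)).PairwiseDisjoint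
      (fun ki : ℕ × ℕ => (boxA N₀ T j δ ki.1 ki.2) ×ˢ (boxB N₀ T X δ ki.1)) := by
  intro ki _ ki' _ hne
  rw [Function.onFun, Finset.disjoint_left]
  intro x hx hx'
  simp only [Finset.mem_product, Finset.mem_filter] at hx hx'
  apply hne
  have hk : ki.1 = ki'.1 := InBox.eq_of_inBox hX hδ hx.2.2 hx'.2.2
  have hi : ki.2 = ki'.2 := by
    have h1 := hx.1.2
    have h2 := hx'.1.2
    rw [← hk] at h2
    exact InBox.eq_of_inBox (by positivity) zero_le_one h1 h2
  exact Prod.ext hk hi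

/-- **Covering**: if `(1+δ)^K > X`, a pair `(m, p)` with `X 2^{-I} < m p ≤ X/(1+δ)` lies in a box
`(k, i)` with `k < K`, `i < I`. [folklore] -/
theorem exists_box_of_mem_pairs {N₀ j : ℕ} {X δ : ℝ} (hX : 0 < X) (hδ : 0 < δ) {K I : ℕ}
    (hK : X < (1 + δ) ^ K) {x : ℕ × ℕ} (hx : x ∈ pairs N₀ ⌊X⌋₊ j)
    (hlo : X / 2 ^ I < (x.1 : ℝ) * x.2) (hhi : (x.1 : ℝ) * x.2 ≤ X / (1 + δ)) :
    ∃ ki ∈ Finset.range K ×ˢ Finset.range I,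
      x ∈ (boxA N₀ ⌊X⌋₊ j δ ki.1 ki.2) ×ˢ (boxB N₀ ⌊X⌋₊ X δ ki.1) := by
  obtain ⟨⟨hm, hmj⟩, ⟨⟨hp1, hpT⟩, hp, hNp⟩, -⟩ := mem_pairs_iff.1 hx
  have hm1 : 1 ≤ x.1 := (Finset.mem_Icc.1 (roughIcc_subset_Icc _ _ hm)).1
  have hpX : (x.2 : ℝ) ≤ X := le_trans (by exact_mod_cast hpT) (Nat.floor_le hX.le)
  have hp0 : (0 : ℝ) < x.2 := by exact_mod_cast hp1
  have hlowp : X / (1 + δ) ^ K < x.2 := by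
    have h1 : X / (1 + δ) ^ K < 1 := by rw [div_lt_one (by positivity)]; exact hK
    exact lt_of_lt_of_le h1 (by exact_mod_cast hp1)
  obtain ⟨k, hkK, hkbox⟩ := exists_inBox_lt hp1 hlowp hpX
  set T' : ℝ := (1 + δ) ^ k with hT'
  have hT'0 : 0 < T' := by positivity
  have hplo : X / (1 + δ) ^ (k + 1) < x.2 := hkbox.2.1
  have hphi : (x.2 : ℝ) ≤ X / (1 + δ) ^ k := hkbox.2.2
  -- `m ≤ (1+δ)^k`
  have hm_hi : (x.1 : ℝ) ≤ T' := by
    by_contra hcon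
    push Not at hcon
    have h1 : (x.1 : ℝ) * x.2 * (1 + δ) ≤ X := by rw [← le_div_iff₀ (by linarith)]; exact hhi
    have h2 : X < x.2 * (1 + δ) ^ (k + 1) := by rwa [div_lt_iff₀ (by positivity)] at hplo
    have h3 : T' * x.2 * (1 + δ) < (x.1 : ℝ) * x.2 * (1 + δ) := by gcongr
    have h4 : T' * x.2 * (1 + δ) = x.2 * (1 + δ) ^ (k + 1) := by rw [hT', pow_succ]; ring
    linarith
  -- `m > (1+δ)^k / 2^I`
  have hm_lo : T' / (1 + 1) ^ I < x.1 := by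
    have h1 : (x.2 : ℝ) * T' ≤ X := (le_div_iff₀ hT'0).1 hphi
    have h2 : T' / (1 + 1) ^ I * x.2 ≤ X / 2 ^ I := by
      rw [show ((1 : ℝ) + 1) = 2 by norm_num, div_mul_eq_mul_div]
      refine div_le_div_of_nonneg_right ?_ (by positivity)
      rw [mul_comm]; exact h1
    exact lt_of_mul_lt_mul_right (lt_of_le_of_lt h2 hlo) hp0.le
  obtain ⟨i, hiI, hibox⟩ := exists_inBox_lt hm1 hm_lo hm_hi
  refine ⟨(k, i), Finset.mem_product.2 ⟨Finset.mem_range.2 hkK, Finset.mem_range.2 hiI⟩, ?_⟩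
  simp only [Finset.mem_product, Finset.mem_filter]
  exact ⟨⟨⟨hm, hmj⟩, hibox⟩, ⟨Finset.mem_Icc.2 ⟨hp1, hpT⟩, hp, hNp⟩, hkbox⟩

/-- The pairs missed by the boxes have `m p ≤ X 2^{-I}` or `m p > X/(1+δ)`. [folklore] -/
theorem pairs_sdiff_boxes_subset {N₀ j : ℕ} {X δ : ℝ} (hX : 0 < X) (hδ : 0 < δ) {K : ℕ}
    (hK : X < (1 + δ) ^ K) (I : ℕ) :
    pairs N₀ ⌊X⌋₊ j \ (Finset.range K ×ˢ Finset.range I).biUnion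
        (fun ki : ℕ × ℕ => (boxA N₀ ⌊X⌋₊ j δ ki.1 ki.2) ×ˢ (boxB N₀ ⌊X⌋₊ X δ ki.1)) ⊆
      (pairs N₀ ⌊X⌋₊ j).filter (fun x : ℕ × ℕ =>
        ((x.1 * x.2 : ℕ) : ℝ) ≤ X / 2 ^ I ∨ X / (1 + δ) < ((x.1 * x.2 : ℕ) : ℝ)) := by
  intro x hx
  rw [Finset.mem_sdiff] at hx
  rw [Finset.mem_filter]
  refine ⟨hx.1, ?_⟩
  by_contra hcon
  push Not at hcon
  rw [Nat.cast_mul] at hcon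
  obtain ⟨ki, hki, hxki⟩ := exists_box_of_mem_pairs hX hδ hK hx.1 hcon.1 hcon.2
  exact hx.2 (Finset.mem_biUnion.2 ⟨ki, hki, hxki⟩)

/-! ### Splitting the pair discrepancy over the boxes -/

/-- Cardinalities of a filter over the disjoint union of the boxes. [folklore] -/
theorem card_filter_biUnion_boxes {N₀ T j : ℕ} {X δ : ℝ} (hX : 0 < X) (hδ : 0 ≤ δ) (s : Finset (ℕ × ℕ))
    (P : ℕ × ℕ → Prop) [DecidablePred P] :
    #((s.biUnion (fun ki : ℕ × ℕ => (boxA N₀ T j δ ki.1 ki.2) ×ˢ (boxB N₀ T X δ ki.1))).filter P) =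
      ∑ ki ∈ s, #(((boxA N₀ T j δ ki.1 ki.2) ×ˢ (boxB N₀ T X δ ki.1)).filter P) := by
  rw [Finset.filter_biUnion, Finset.card_biUnion]
  exact (pairwiseDisjoint_boxes hX hδ s).mono fun ki => Finset.filter_subset _ _

/-- **The pair discrepancy splits over the boxes**: with `rest = pairs ∖ ⋃ boxes`,
`D(pairs) = Σ_{k<K, i<I} D(box (k,i)) + D(rest)`. [folklore] -/
theorem pairDisc_eq_sum_boxes_add {N₀ j : ℕ} {X δ : ℝ} (hX : 0 < X) (hδ : 0 ≤ δ) (K I q c : ℕ) :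
    ((#((pairs N₀ ⌊X⌋₊ j).filter (fun x : ℕ × ℕ => x.1 * x.2 ≡ c [MOD q])) : ℝ) -
        (#((pairs N₀ ⌊X⌋₊ j).filter (fun x : ℕ × ℕ => (x.1 * x.2).Coprime q)) : ℝ) / (Nat.totient q : ℝ)) =
      (∑ ki ∈ Finset.range K ×ˢ Finset.range I,
        ((#(((boxA N₀ ⌊X⌋₊ j δ ki.1 ki.2) ×ˢ (boxB N₀ ⌊X⌋₊ X δ ki.1)).filter
            (fun x : ℕ × ℕ => x.1 * x.2 ≡ c [MOD q])) : ℝ) -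
          (#(((boxA N₀ ⌊X⌋₊ j δ ki.1 ki.2) ×ˢ (boxB N₀ ⌊X⌋₊ X δ ki.1)).filter
            (fun x : ℕ × ℕ => (x.1 * x.2).Coprime q)) : ℝ) / (Nat.totient q : ℝ))) +
      ((#((pairs N₀ ⌊X⌋₊ j \ (Finset.range K ×ˢ Finset.range I).biUnion
            (fun ki : ℕ × ℕ => (boxA N₀ ⌊X⌋₊ j δ ki.1 ki.2) ×ˢ (boxB N₀ ⌊X⌋₊ X δ ki.1))).filter
            (fun x : ℕ × ℕ => x.1 * x.2 ≡ c [MOD q])) : ℝ) -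
        (#((pairs N₀ ⌊X⌋₊ j \ (Finset.range K ×ˢ Finset.range I).biUnion
            (fun ki : ℕ × ℕ => (boxA N₀ ⌊X⌋₊ j δ ki.1 ki.2) ×ˢ (boxB N₀ ⌊X⌋₊ X δ ki.1))).filter
            (fun x : ℕ × ℕ => (x.1 * x.2).Coprime q)) : ℝ) / (Nat.totient q : ℝ)) := by
  set main := (Finset.range K ×ˢ Finset.range I).biUnion
    (fun ki : ℕ × ℕ => (boxA N₀ ⌊X⌋₊ j δ ki.1 ki.2) ×ˢ (boxB N₀ ⌊X⌋₊ X δ ki.1)) with hmain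
  have hsub : main ⊆ pairs N₀ ⌊X⌋₊ j := by
    rw [hmain]
    refine Finset.biUnion_subset.2 fun ki _ => product_boxes_subset_pairs hδ ki.1 ki.2
  have hsplit : ∀ (P : ℕ × ℕ → Prop) [DecidablePred P],
      (#((pairs N₀ ⌊X⌋₊ j).filter P) : ℝ) =
        (∑ ki ∈ Finset.range K ×ˢ Finset.range I,
          (#(((boxA N₀ ⌊X⌋₊ j δ ki.1 ki.2) ×ˢ (boxB N₀ ⌊X⌋₊ X δ ki.1)).filter P) : ℝ)) +
        #((pairs N₀ ⌊X⌋₊ j \ main).filter P) := by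
    intro P _
    have hu : pairs N₀ ⌊X⌋₊ j = main ∪ (pairs N₀ ⌊X⌋₊ j \ main) := (Finset.union_sdiff_of_subset hsub).symm
    have hd : Disjoint (main.filter P) ((pairs N₀ ⌊X⌋₊ j \ main).filter P) :=
      Finset.disjoint_filter_filter Finset.disjoint_sdiff
    rw [hu, Finset.filter_union, Finset.card_union_of_disjoint hd, Nat.cast_add, hmain,
      card_filter_biUnion_boxes hX hδ, Nat.cast_sum]
    rw [← hmain, ← hu]
  rw [hsplit, hsplit, Finset.sum_sub_distrib, ← Finset.sum_div]
  ring

/-! ### A box discrepancy is a bilinear discrepancy -/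

/-- A double sum of a product of indicators over dyadic ranges containing the supports is a
cardinality. [folklore] -/
theorem sum_dyadic_sum_dyadic_indicator_eq {M N : ℝ} {A B : Finset ℕ} (hA : A ⊆ dyadic M)
    (hB : B ⊆ dyadic N) (R : ℕ → ℕ → Prop) [∀ m n, Decidable (R m n)] :
    (∑ m ∈ dyadic M, ∑ n ∈ dyadic N,
        if R m n then (if m ∈ A then (1 : ℝ) else 0) * (if n ∈ B then (1 : ℝ) else 0) else 0) =
      #((A ×ˢ B).filter (fun x : ℕ × ℕ => R x.1 x.2)) := by
  have hz : ∀ x ∈ dyadic M ×ˢ dyadic N, x ∉ A ×ˢ B →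
      (if R x.1 x.2 then (if x.1 ∈ A then (1 : ℝ) else 0) * (if x.2 ∈ B then (1 : ℝ) else 0) else 0) = 0 := by
    intro x _ hx
    rw [Finset.mem_product, not_and_or] at hx
    rcases hx with h | h
    · rw [if_neg h, zero_mul, ite_self]
    · rw [if_neg h, mul_zero, ite_self]
  rw [← Finset.sum_product', ← Finset.sum_subset (Finset.product_subset_product hA hB) hz,
    ← Finset.sum_boole]
  refine Finset.sum_congr rfl fun x hx => ?_
  rw [Finset.mem_product] at hx
  rw [if_pos hx.1, if_pos hx.2, mul_one]

/-- The `m`-box lies in the dyadic range `M = (1+δ)^k 2^{-i-1}`. [folklore] -/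
theorem boxA_subset_dyadic {N₀ T j : ℕ} {δ : ℝ} (hδ : 0 ≤ δ) (k i : ℕ) :
    boxA N₀ T j δ k i ⊆ dyadic ((1 + δ) ^ k / 2 ^ (i + 1)) := by
  intro m hm
  rw [Finset.mem_filter] at hm
  obtain ⟨-, -, h1, h2⟩ := hm
  unfold boxLow at h1
  unfold boxHigh at h2
  rw [mem_dyadic (by positivity)]
  norm_num at h1 h2
  refine ⟨h1, ?_⟩
  rw [pow_succ]
  have : (2 : ℝ) * ((1 + δ) ^ k / (2 ^ i * 2)) = (1 + δ) ^ k / 2 ^ i := by field_simp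
  rw [this]; exact h2

/-- The prime box lies in the dyadic range `N = X (1+δ)^{-k-1}` (`0 ≤ δ ≤ 1`). [folklore] -/
theorem boxB_subset_dyadic {N₀ T : ℕ} {X δ : ℝ} (hX : 0 ≤ X) (hδ : 0 ≤ δ) (hδ1 : δ ≤ 1) (k : ℕ) :
    boxB N₀ T X δ k ⊆ dyadic (X / (1 + δ) ^ (k + 1)) := by
  intro p hp
  rw [Finset.mem_filter] at hp
  obtain ⟨-, -, h1, h2⟩ := hp
  unfold boxLow at h1
  unfold boxHigh at h2
  rw [mem_dyadic (by positivity)]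
  refine ⟨h1, h2.trans ?_⟩
  have : X / (1 + δ) ^ k = (1 + δ) * (X / (1 + δ) ^ (k + 1)) := by
    rw [pow_succ]; field_simp
  rw [this]
  exact mul_le_mul_of_nonneg_right (by linarith) (by positivity)

/-- **The discrepancy of a box is `BFI.bilinDisc`** of the two indicators at the scales
`M = (1+δ)^k 2^{-i-1}`, `N = X (1+δ)^{-k-1}`, residue `c`. [folklore] -/
theorem pairDisc_box_eq_bilinDisc {N₀ T j : ℕ} {X δ : ℝ} (hX : 0 ≤ X) (hδ : 0 ≤ δ) (hδ1 : δ ≤ 1)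
    (k i q c : ℕ) :
    ((#(((boxA N₀ T j δ k i) ×ˢ (boxB N₀ T X δ k)).filter (fun x : ℕ × ℕ => x.1 * x.2 ≡ c [MOD q])) : ℝ) -
        (#(((boxA N₀ T j δ k i) ×ˢ (boxB N₀ T X δ k)).filter (fun x : ℕ × ℕ => (x.1 * x.2).Coprime q)) : ℝ) /
          (Nat.totient q : ℝ)) =
      bilinDisc (c : ℤ) ((1 + δ) ^ k / 2 ^ (i + 1)) (X / (1 + δ) ^ (k + 1))
        (fun m => if m ∈ boxA N₀ T j δ k i then (1 : ℝ) else 0)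
        (fun p => if p ∈ boxB N₀ T X δ k then (1 : ℝ) else 0) q := by
  unfold bilinDisc
  rw [sum_dyadic_sum_dyadic_indicator_eq (boxA_subset_dyadic hδ k i) (boxB_subset_dyadic hX hδ hδ1 k),
    sum_dyadic_sum_dyadic_indicator_eq (boxA_subset_dyadic hδ k i) (boxB_subset_dyadic hX hδ hδ1 k)]
  simp only [Int.cast_natCast, ZMod.natCast_eq_natCast_iff]

/-- `‖1_A‖² ≤ 2M + 1` over the dyadic range `m ∼ M`. [folklore] -/
theorem l2Sq_indicator_le {M : ℝ} (hM : 0 ≤ M) (A : Finset ℕ) :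
    l2Sq M (fun m => if m ∈ A then (1 : ℝ) else 0) ≤ 2 * M + 1 := by
  unfold l2Sq
  calc ∑ n ∈ dyadic M, (if n ∈ A then (1 : ℝ) else 0) ^ 2 ≤ ∑ n ∈ dyadic M, (1 : ℝ) :=
        Finset.sum_le_sum fun n _ => by split_ifs <;> norm_num
    _ = #(dyadic M) := by simp
    _ ≤ 2 * M + 1 := card_dyadic_le hM

/-- **The prime box is a prime piece**: for `N₀ ≥ 1` and `X ≥ 0`, the indicator of
`{p ∈ primesIn N₀ ⌊X⌋ : InBox X δ k p}` is `primePiece m m'` with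
`m = max (N₀ − 1) ⌊X(1+δ)^{-k-1}⌋`, `m' = min ⌊X⌋ ⌊X(1+δ)^{-k}⌋`. [folklore] -/
theorem indicator_boxB_eq_primePiece {N₀ : ℕ} (hN₀ : 1 ≤ N₀) {X δ : ℝ} (hX : 0 ≤ X) (hδ : 0 ≤ δ) (k : ℕ) :
    (fun p => if p ∈ boxB N₀ ⌊X⌋₊ X δ k then (1 : ℝ) else 0) =
      ⇑(primePiece (max (N₀ - 1) ⌊X / (1 + δ) ^ (k + 1)⌋₊) (min ⌊X⌋₊ ⌊X / (1 + δ) ^ k⌋₊)) := by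
  funext p
  rw [primePiece_apply]
  have h0 : 0 ≤ X / (1 + δ) ^ (k + 1) := by positivity
  have h0' : 0 ≤ X / (1 + δ) ^ k := by positivity
  have hiff : p ∈ boxB N₀ ⌊X⌋₊ X δ k ↔
      max (N₀ - 1) ⌊X / (1 + δ) ^ (k + 1)⌋₊ < p ∧ p ≤ min ⌊X⌋₊ ⌊X / (1 + δ) ^ k⌋₊ ∧ p.Prime := by
    rw [Finset.mem_filter, Finset.mem_filter, Finset.mem_Icc, max_lt_iff, le_min_iff, Nat.floor_lt h0,
      Nat.le_floor_iff h0']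
    unfold InBox boxLow boxHigh
    constructor
    · rintro ⟨⟨⟨h1, h2⟩, hp, hN⟩, h3, h4, h5⟩
      exact ⟨⟨by omega, h4⟩, ⟨h2, h5⟩, hp⟩
    · rintro ⟨⟨h1, h4⟩, ⟨h2, h5⟩, hp⟩
      exact ⟨⟨⟨hp.one_lt.le, h2⟩, hp, by omega⟩, hp.pos, h4, h5⟩
  by_cases h : p ∈ boxB N₀ ⌊X⌋₊ X δ k
  · rw [if_pos h, if_pos (hiff.1 h)]
  · rw [if_neg h, if_neg (fun h' => h (hiff.2 h'))]

end RoughCellsAP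

end Literature.NumberTheory.Sieve
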